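import Summits.QuantumFields.YangMills.Theorems.BalabanUVNodesN22Knit

/-!
# BalabanUVNodes ∕ N22 knit, VERTEX-FREE DERIVATIVE-FREE FORM — node N22 = NE9 (`T4OutputRate.NE9 ∧ FadingMemory`) BY NAME from
# OSCILLATION FADING (tower-NE5) + a SECOND-DIFFERENCE bound on `]0, γ]` in each young coupling (no derivative, nothing at the vertex
# `g = 0`), by a DISCRETE Landau–Kolmogorov interpolation (Track A, DAG node N22; cluster K4 «SpineRates»; seat `pub-ymgap-dag-n22-a`)

HONEST FRAMING.  Count-neutral kernel bookkeeping over hypothesis shapes on the ABSTRACT carriers `T4OutputRate.Carriers`; NOT a node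
discharge; NE5 ∕ NE9 NOT IN PRINT, NOT PROVED; instance on Bałaban's `E^{(j)}` 0∕1 (wall W1 unchanged); one finite four-torus programme at
fixed ε; nothing continuum ∕ ℝ⁴ ∕ OS ∕ mass-gap ∕ Clay.  0 `sorry`, 0 `def`, standard axioms.  `--supports` item `SpineGivenEndpoint`.

WHY.  `BalabanUVNodesN22Knit.ne9_and_fadingMemory_of_osc_growingSmooth` assumes (R): each young-coupling section `t ↦ E (update g i t) U X`
is DIFFERENTIABLE within the CLOSED interval `[0, γ]` with a Lipschitz derivative.  For Bałaban's scheme the vertex `g → 0⁺` is delicate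
(pv10's (W1)∕(L2): no g-independent analyticity radius there; `T4CouplingAnalyticity.exists_couplingAnalyticRel_not_ne9Window`), and what a
body-level estimate of [Balaban1987RG1] (2.13) `𝐄^{(k+1)} = log ∫ χ e^{𝐏 + {…}} dμ` naturally delivers is a bound on SECOND DIFFERENCES ∕
second derivatives in the coupling (a tilted variance + an expectation of a second derivative) ON THE OPEN INTERVAL.  THIS FILE removes both
frictions: the regularity clause becomes
(R₂)  `|E(g[i ↦ t+d]) − 2·E(g[i ↦ t]) + E(g[i ↦ t−d])| ≤ M·μ^{scale X − 1 − i}·e^{−κd(X)}·d²` whenever `t ± d ∈ ]0, γ]`, `i < scale X`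
— no derivative, no value at `g_i = 0`, constants allowed to GROW with the age like `μ^{age}` — and the conclusion is the same:
* §1 DISCRETE LANDAU–KOLMOGOROV on `]0, γ]` (`abs_sub_le_of_osc_of_secondDiff`): oscillation `≤ ε` + second differences `≤ M d²` ⟹
  `|f x − f y| ≤ (2ε∕h₀ + M h₀)·|x − y|` for every window `0 < h₀ ≤ γ∕2` (increments along an arithmetic progression drift by at most `m·M d²`;
  `n = ⌊h₀∕|x−y|⌋` steps fit on one side).
* §2 `coordLipschitzOn_of_osc_secondDiff` — (O) + (R₂) ⟹ pv10's `T4CouplingAnalyticity.CoordLipschitzOn ]0, γ] E κ Λ₁` with the FADING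
  moduli `Λ₁ k i = C₉·τ^{k−i}`, `C₉ = (4C₀∕γ + Mγ∕2)∕τ`, for every step ratio `ρ ∈ ]0, 1]` and rate `τ > 0` with `θ ≤ τρ`, `μρ ≤ τ`
  (window `h₀ = (γ∕2)·ρ^{age−1}`); fading (`τ < 1`) available iff `θμ < 1`.
* §3 HEADLINE `ne9_and_fadingMemory_of_osc_secondDiff` — (P) ∧ (O) ∧ (R₂) ⟹ **`NE9 E (Window γ) κ Λ₁ ∧ FadingMemory C₉ τ Λ₁`**, node N22's
  statement of record BY NAME (pv10's telescoping `ne9_of_coordLipschitz` + `N22Knit.fadingMemory_geometric`).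
* §4 `towerNE9_fadingMemory_of_towerNE5_secondDiff` — with ne9's tower of carriers: `TowerNE5` (node N18 along the tower,
  `N22Knit.oscFading_of_towerNE5`) ∧ (P) ∧ (R₂) at every level ⟹ `TowerNE9 T E γ κ Λ₁ ∧ FadingMemory C₉ τ Λ₁`.

References (TYPES only): [Balaban1987RG1] = T. Bałaban, Commun. Math. Phys. **109** (1987) 249–301 — p. 256 (prefix dependence), Thm 1
p. 259, (1.18) and the C^∞ clause p. 263, (2.13) p. 268.
-/

noncomputable section

namespace Summit.QuantumFields.YangMills.BalabanUVNodes.N22KnitDiscrete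

open Set
open scoped BigOperators
open Literature.MathematicalPhysics.QuantumFieldTheory.Balaban1983to89
open Literature.MathematicalPhysics.QuantumFieldTheory.Balaban1983to89.T4OutputRate
open Literature.MathematicalPhysics.QuantumFieldTheory.Balaban1983to89.T4CouplingAnalyticity
  (CoordLipschitzOn update_mem_boxWindow ne9_of_coordLipschitz)
open Summit.QuantumFields.YangMills.BalabanUVNodes.N22Knit (fadingMemory_geometric oscFading_of_towerNE5)
open Summit.QuantumFields.BalabanUV.T4Continuum.NE9.TowerCarriers (TowerData TowerNE5 TowerNE9)

/-! ## §1 Discrete Landau–Kolmogorov on `]0, γ]` -/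


/-- Increments along an arithmetic progression: if the second differences are `≤ B` then the `m`-th increment is within `m·B` of the
first one. [folklore] -/
theorem abs_inc_sub_inc_le {f : ℝ → ℝ} {x d B : ℝ} {n : ℕ}
    (h2 : ∀ m : ℕ, m + 2 ≤ n → |f (x + (m + 2) * d) - 2 * f (x + (m + 1) * d) + f (x + m * d)| ≤ B) :
    ∀ m : ℕ, m + 1 ≤ n → |(f (x + (m + 1) * d) - f (x + m * d)) - (f (x + d) - f x)| ≤ m * B := by
  intro m
  induction m with
  | zero => intro _; simp
  | succ m ih =>
    intro hm
    have h := h2 m (by omega)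
    have ih' := ih (by omega)
    have e : (f (x + ((m : ℝ) + 1 + 1) * d) - f (x + ((m : ℝ) + 1) * d)) - (f (x + d) - f x)
        = (f (x + (m + 2) * d) - 2 * f (x + (m + 1) * d) + f (x + m * d))
          + ((f (x + (m + 1) * d) - f (x + m * d)) - (f (x + d) - f x)) := by ring
    push_cast
    rw [e]
    calc |_| ≤ |f (x + (m + 2) * d) - 2 * f (x + (m + 1) * d) + f (x + m * d)|
          + |(f (x + (m + 1) * d) - f (x + m * d)) - (f (x + d) - f x)| := abs_add_le _ _
      _ ≤ B + m * B := add_le_add h ih'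
      _ = (m + 1 : ℝ) * B := by ring

/-- Telescoping over `n` increments: `n·|f (x + d) − f x| ≤ |f (x + n·d) − f x| + n²·B` when the second differences along the progression
are `≤ B`, `B ≥ 0`. [folklore] -/
theorem mul_abs_inc_le {f : ℝ → ℝ} {x d B : ℝ} (n : ℕ) (hB : 0 ≤ B)
    (h2 : ∀ m : ℕ, m + 2 ≤ n → |f (x + (m + 2) * d) - 2 * f (x + (m + 1) * d) + f (x + m * d)| ≤ B) :
    (n : ℝ) * |f (x + d) - f x| ≤ |f (x + n * d) - f x| + (n : ℝ) * (n : ℝ) * B := by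
  have hinc := abs_inc_sub_inc_le h2
  -- Σ_{m<n} inc_m = f(x + n d) - f x
  have htel : ∑ m ∈ Finset.range n, (f (x + (m + 1 : ℕ) * d) - f (x + m * d)) = f (x + n * d) - f x := by
    rw [Finset.sum_range_sub (fun m => f (x + (m : ℕ) * d))]
    simp
  -- n * inc₀ = Σ inc_m - Σ (inc_m - inc₀)
  have hkey : (n : ℝ) * (f (x + d) - f x)
      = (f (x + n * d) - f x) - ∑ m ∈ Finset.range n, ((f (x + (m + 1 : ℕ) * d) - f (x + m * d)) - (f (x + d) - f x)) := by
    rw [Finset.sum_sub_distrib, htel, Finset.sum_const, Finset.card_range, nsmul_eq_mul]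
    ring
  have hsum : 0 ≤ B → |∑ m ∈ Finset.range n, ((f (x + (m + 1 : ℕ) * d) - f (x + m * d)) - (f (x + d) - f x))|
      ≤ (n : ℝ) * (n : ℝ) * B := fun hB => by
    calc _ ≤ ∑ m ∈ Finset.range n, |(f (x + (m + 1 : ℕ) * d) - f (x + m * d)) - (f (x + d) - f x)| :=
          Finset.abs_sum_le_sum_abs _ _
      _ ≤ ∑ m ∈ Finset.range n, (n : ℝ) * B := Finset.sum_le_sum fun m hm => by
          have h1 := hinc m (Finset.mem_range.mp hm)
          push_cast at h1 ⊢
          have hmn : (m : ℝ) ≤ n := by exact_mod_cast (Finset.mem_range.mp hm).le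
          exact h1.trans (mul_le_mul_of_nonneg_right hmn hB)
      _ = (n : ℝ) * (n : ℝ) * B := by rw [Finset.sum_const, Finset.card_range, nsmul_eq_mul]; ring
  have h3 := hsum hB
  rw [← abs_of_nonneg (Nat.cast_nonneg n : (0:ℝ) ≤ n), ← abs_mul, abs_of_nonneg (Nat.cast_nonneg n : (0:ℝ) ≤ n), hkey]
  exact (abs_sub _ _).trans (add_le_add le_rfl h3)

/-- ONE-SIDED DISCRETE LANDAU along a progression to the right: base `x`, step `d`, `n ≥ 1` steps; if `|f (x + n·d) − f x| ≤ ε` and the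
second differences along the progression are `≤ M·d²` (`M ≥ 0`), then `|f (x + d) − f x| ≤ ε∕n + n·M·d²`. [folklore] -/
theorem abs_inc_le_right {f : ℝ → ℝ} {x d ε M : ℝ} {n : ℕ} (hn : 1 ≤ n) (hM : 0 ≤ M)
    (hosc : |f (x + n * d) - f x| ≤ ε)
    (h2 : ∀ m : ℕ, m + 2 ≤ n → |f (x + (m + 2) * d) - 2 * f (x + (m + 1) * d) + f (x + m * d)| ≤ M * d ^ 2) :
    |f (x + d) - f x| ≤ ε / n + n * (M * d ^ 2) := by
  have hB : 0 ≤ M * d ^ 2 := by positivity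
  have h := mul_abs_inc_le n hB h2
  have hn' : (0 : ℝ) < n := by exact_mod_cast hn
  rw [div_add' _ _ _ hn'.ne', le_div_iff₀ hn']
  calc |f (x + d) - f x| * n = (n : ℝ) * |f (x + d) - f x| := mul_comm _ _
    _ ≤ |f (x + n * d) - f x| + (n : ℝ) * (n : ℝ) * (M * d ^ 2) := h
    _ ≤ ε + (n : ℝ) * (M * d ^ 2) * n := by nlinarith

/-- **DISCRETE LANDAU–KOLMOGOROV ON `]0, γ]`** (vertex-free, derivative-free).  If the oscillation of `f` on `]0, γ]` is `≤ ε` and its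
SECOND DIFFERENCES satisfy `|f (t + d) − 2f t + f (t − d)| ≤ M·d²` whenever `t ± d ∈ ]0, γ]` (`M ≥ 0`), then for every window `0 < h₀ ≤ γ∕2`:
`|f x − f y| ≤ (2ε∕h₀ + M·h₀)·|x − y|` on `]0, γ]` — for `|x − y| ≥ h₀` the oscillation suffices; otherwise `n = ⌊h₀∕|x − y|⌋ ≥ 1` steps of
size `|x − y|` fit on one side (to the right of `x` if `x ≤ γ∕2`, else to the left of `y`), and the one-sided lemma gives
`ε∕n + n·M·|x − y|² ≤ (2ε∕h₀ + M h₀)·|x − y|`.  No differentiability and no behaviour at the vertex `0` is assumed. [folklore] -/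
theorem abs_sub_le_of_osc_of_secondDiff {f : ℝ → ℝ} {γ ε M h₀ : ℝ}
    (hε : ∀ x ∈ Ioc (0 : ℝ) γ, ∀ y ∈ Ioc (0 : ℝ) γ, |f x - f y| ≤ ε)
    (h2 : ∀ t d : ℝ, 0 < d → t - d ∈ Ioc (0 : ℝ) γ → t + d ∈ Ioc (0 : ℝ) γ → |f (t + d) - 2 * f t + f (t - d)| ≤ M * d ^ 2)
    (hM : 0 ≤ M) (hh0 : 0 < h₀) (hhγ : h₀ ≤ γ / 2) {x y : ℝ} (hx : x ∈ Ioc (0 : ℝ) γ) (hy : y ∈ Ioc (0 : ℝ) γ) :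
    |f x - f y| ≤ (2 * ε / h₀ + M * h₀) * |x - y| := by
  have hε0 : 0 ≤ ε := by have := hε x hx x hx; simp at this; exact this
  -- symmetric in `x, y`: reduce to `x < y`
  wlog hxy : x < y generalizing x y
  · rcases eq_or_lt_of_le (not_lt.mp hxy) with h | h
    · subst h; simp
    · rw [abs_sub_comm (f x), abs_sub_comm x]; exact this hy hx h
  set d := y - x with hd_def
  have hd : 0 < d := by rw [hd_def]; linarith
  have hxy_abs : |x - y| = d := by rw [abs_sub_comm, hd_def, abs_of_pos hd]
  rw [hxy_abs]
  have hK : 0 ≤ 2 * ε / h₀ + M * h₀ := by positivity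
  by_cases hdh : h₀ ≤ d
  · -- far apart: the oscillation bound alone
    have hMd : 0 ≤ M * h₀ * d := by positivity
    calc |f x - f y| ≤ ε := hε x hx y hy
      _ ≤ 2 * ε / h₀ * d := by
          rw [div_mul_eq_mul_div, le_div_iff₀ hh0]; nlinarith [mul_le_mul_of_nonneg_left hdh hε0]
      _ ≤ (2 * ε / h₀ + M * h₀) * d := by nlinarith
  · rw [not_le] at hdh
    -- `n = ⌊h₀/d⌋ ≥ 1` steps of size `d` fit in a window of length `h₀ ≤ γ/2`
    set n : ℕ := ⌊h₀ / d⌋₊ with hn_def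
    have hq : 1 ≤ h₀ / d := by rw [le_div_iff₀ hd]; linarith
    have hn1 : 1 ≤ n := by rw [hn_def]; exact_mod_cast Nat.one_le_floor_iff _ |>.mpr hq
    have hnle : (n : ℝ) ≤ h₀ / d := Nat.floor_le (by positivity)
    have hnd : (n : ℝ) * d ≤ h₀ := by rwa [le_div_iff₀ hd] at hnle
    have hlt : h₀ / d < n + 1 := by rw [hn_def]; exact Nat.lt_floor_add_one _
    have hnlow : h₀ ≤ 2 * d * n := by
      have hn1' : (1 : ℝ) ≤ n := by exact_mod_cast hn1
      rw [div_lt_iff₀ hd] at hlt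
      nlinarith
    -- the common final arithmetic: `ε/n + n·M·d² ≤ (2ε/h₀ + M h₀)·d`
    have hfin : ε / n + n * (M * d ^ 2) ≤ (2 * ε / h₀ + M * h₀) * d := by
      have hn0 : (0 : ℝ) < n := by exact_mod_cast hn1
      have h1 : ε / n ≤ 2 * ε / h₀ * d := by
        have hpos : 0 < h₀ / (2 * d) := by positivity
        have hle : h₀ / (2 * d) ≤ n := by rw [div_le_iff₀ (by positivity)]; linarith [hnlow]
        calc ε / n ≤ ε / (h₀ / (2 * d)) := div_le_div_of_nonneg_left hε0 hpos hle
          _ = 2 * ε / h₀ * d := by field_simp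
      have h2' : (n : ℝ) * (M * d ^ 2) ≤ M * h₀ * d := by nlinarith [mul_nonneg hM hd.le]
      nlinarith
    by_cases hxl : x ≤ γ / 2
    · -- go RIGHT from `x`: the points `x + m d`, `m ≤ n`, lie in `]0, γ]`
      have hpts : ∀ m : ℕ, m ≤ n → x + m * d ∈ Ioc (0 : ℝ) γ := fun m hm => by
        have hm' : (m : ℝ) ≤ n := by exact_mod_cast hm
        constructor <;> nlinarith [hx.1, hx.2, hd]
      have key := abs_inc_le_right (f := f) (x := x) (ε := ε) hn1 hM
        (by simpa using hε _ (hpts n le_rfl) _ hx) (fun m hm => by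
          have := h2 (x + (m + 1) * d) d hd
            (by rw [show x + ((m:ℝ) + 1) * d - d = x + m * d by ring]; exact hpts m (by omega))
            (by rw [show x + ((m:ℝ) + 1) * d + d = x + ((m + 2 : ℕ) : ℝ) * d by push_cast; ring]; exact hpts (m + 2) hm)
          rwa [show x + ((m:ℝ) + 1) * d + d = x + (m + 2) * d by ring,
            show x + ((m:ℝ) + 1) * d - d = x + m * d by ring] at this)
      rw [show y = x + d by rw [hd_def]; ring, abs_sub_comm]
      exact key.trans hfin
    · -- go LEFT from `y`: apply the right-going lemma to `t ↦ f (−t)` at the base `−y`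
      rw [not_le] at hxl
      have hpts : ∀ m : ℕ, m ≤ n → y - m * d ∈ Ioc (0 : ℝ) γ := fun m hm => by
        have hm' : (m : ℝ) ≤ n := by exact_mod_cast hm
        constructor <;> nlinarith [hy.1, hy.2, hd]
      have key := abs_inc_le_right (f := fun t => f (-t)) (x := -y) (ε := ε) hn1 hM
        (by
          have := hε _ (hpts n le_rfl) _ hy
          show |f (-(-y + (n:ℝ) * d)) - f (-(-y))| ≤ ε
          rw [show -(-y + (n:ℝ) * d) = y - n * d by ring, neg_neg]
          exact this)
        (fun m hm => by
          have := h2 (y - (m + 1) * d) d hd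
            (by rw [show y - ((m:ℝ) + 1) * d - d = y - ((m + 2 : ℕ) : ℝ) * d by push_cast; ring]; exact hpts (m + 2) hm)
            (by rw [show y - ((m:ℝ) + 1) * d + d = y - m * d by ring]; exact hpts m (by omega))
          show |f (-(-y + ((m:ℝ) + 2) * d)) - 2 * f (-(-y + ((m:ℝ) + 1) * d)) + f (-(-y + (m:ℝ) * d))| ≤ M * d ^ 2
          rw [show -(-y + ((m:ℝ) + 2) * d) = y - (m + 1) * d - d by ring,
            show -(-y + ((m:ℝ) + 1) * d) = y - (m + 1) * d by ring,
            show -(-y + (m:ℝ) * d) = y - (m + 1) * d + d by ring]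
          rwa [show f (y - ((m:ℝ) + 1) * d + d) - 2 * f (y - ((m:ℝ) + 1) * d) + f (y - ((m:ℝ) + 1) * d - d)
              = f (y - ((m:ℝ) + 1) * d - d) - 2 * f (y - ((m:ℝ) + 1) * d) + f (y - ((m:ℝ) + 1) * d + d) by ring] at this)
      have e1 : -(-y + d) = x := by rw [hd_def]; ring
      have key' : |f x - f y| ≤ ε / n + n * (M * d ^ 2) := by
        have k := key
        simp only [e1, neg_neg] at k
        exact k
      exact key'.trans hfin


/-! ## §2 On the carriers: (O) + second differences ⇒ `CoordLipschitzOn ]0, γ]` with fading moduli -/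

section Abstract

variable {C : Carriers} {Bg : Type} {E : Functional C Bg}

/-- **(O) + (R₂) ⇒ COORDINATEWISE FADING LIPSCHITZ MODULI, VERTEX-FREE.**  (O) oscillation fading with constant `C₀ ≥ 0` and rate
`θ ≥ 0`; (R₂) second differences of each young-coupling section on `]0, γ]` bounded by `M·μ^{scale X − 1 − i}·e^{−κd(X)}·d²` (`M, μ ≥ 0`,
`γ > 0`); a step ratio `ρ ∈ ]0, 1]` and a rate `τ > 0` with `θ ≤ τρ`, `μρ ≤ τ`.  Then `CoordLipschitzOn ]0, γ] E κ Λ₁` with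
`Λ₁ k i = C₉·τ^{k−i}`, `C₉ = (4C₀∕γ + Mγ∕2)∕τ` — §1 with the window `h₀ = (γ∕2)·ρ^{a}`, `a = scale X − 1 − i`, on the section
`t ↦ E (update g i t) U X`, whose oscillation (O) caps by `C₀θ^{a}e^{−κd(X)}` (the histories agree at every index `≥ i + 1`). [folklore] -/
theorem coordLipschitzOn_of_osc_secondDiff {γ κ C₀ θ M μ ρ τ : ℝ}
    (hO : ∀ g ∈ Window γ, ∀ g' ∈ Window γ, ∀ (U : Bg) (X : C.Dom) (a : ℕ), a ≤ C.scale X →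
      (∀ n, a ≤ n → g n = g' n) → |E g U X - E g' U X| ≤ C₀ * θ ^ (C.scale X - a) * Real.exp (-(κ * C.d X)))
    (hR2 : ∀ g ∈ Window γ, ∀ (U : Bg) (X : C.Dom) (i : ℕ), i < C.scale X → ∀ t d : ℝ, 0 < d →
      t - d ∈ Ioc (0 : ℝ) γ → t + d ∈ Ioc (0 : ℝ) γ →
        |E (Function.update g i (t + d)) U X - 2 * E (Function.update g i t) U X + E (Function.update g i (t - d)) U X| ≤
          M * μ ^ (C.scale X - 1 - i) * Real.exp (-(κ * C.d X)) * d ^ 2)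
    (hC₀ : 0 ≤ C₀) (hθ0 : 0 ≤ θ) (hM : 0 ≤ M) (hμ : 0 ≤ μ) (hγ : 0 < γ) (hρ0 : 0 < ρ) (hρ1 : ρ ≤ 1)
    (hθτρ : θ ≤ τ * ρ) (hμρτ : μ * ρ ≤ τ) (hτ0 : 0 < τ) :
    CoordLipschitzOn (Ioc (0 : ℝ) γ) E κ (fun k i => (4 * C₀ / γ + M * γ / 2) / τ * τ ^ (k - i)) := by
  intro U X g hg i hi s hs s' hs'
  set a : ℕ := C.scale X - 1 - i with ha
  set w : ℝ := Real.exp (-(κ * C.d X)) with hw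
  have hw0 : 0 < w := Real.exp_pos _
  set f : ℝ → ℝ := fun t => E (Function.update g i t) U X with hf
  -- oscillation of the section on `]0, γ]`
  have hosc : ∀ x ∈ Ioc (0 : ℝ) γ, ∀ y ∈ Ioc (0 : ℝ) γ, |f x - f y| ≤ C₀ * θ ^ a * w := by
    intro x hx y hy
    have hagree : ∀ n, i + 1 ≤ n → Function.update g i x n = Function.update g i y n := fun n hn => by
      have hni : n ≠ i := by omega
      rw [Function.update_of_ne hni, Function.update_of_ne hni]
    have h := hO _ (update_mem_boxWindow hg i hx) _ (update_mem_boxWindow hg i hy) U X (i + 1) (by omega) hagree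
    rwa [show C.scale X - (i + 1) = a by omega] at h
  -- second differences of the section
  have h2 : ∀ t d : ℝ, 0 < d → t - d ∈ Ioc (0 : ℝ) γ → t + d ∈ Ioc (0 : ℝ) γ →
      |f (t + d) - 2 * f t + f (t - d)| ≤ M * μ ^ a * w * d ^ 2 :=
    fun t d hd h1 h2 => hR2 g hg U X i hi t d hd h1 h2
  -- the window `h₀ = (γ/2)·ρ^a`
  have hρa : 0 < ρ ^ a := pow_pos hρ0 a
  have hρa1 : ρ ^ a ≤ 1 := pow_le_one₀ hρ0.le hρ1
  have hh0 : 0 < γ / 2 * ρ ^ a := by positivity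
  have hhγ : γ / 2 * ρ ^ a ≤ γ / 2 := by nlinarith
  have hMa : 0 ≤ M * μ ^ a * w := by positivity
  have key := abs_sub_le_of_osc_of_secondDiff hosc h2 hMa hh0 hhγ hs hs'
  -- `2ε/h₀ + M_a h₀ ≤ w·(4C₀/γ + Mγ/2)·τ^a`, using `θ^a ≤ τ^a ρ^a` and `μ^a ρ^a ≤ τ^a`
  have hθa : θ ^ a ≤ τ ^ a * ρ ^ a := by
    rw [← mul_pow]; exact pow_le_pow_left₀ hθ0 hθτρ a
  have hμa : μ ^ a * ρ ^ a ≤ τ ^ a := by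
    rw [← mul_pow]; exact pow_le_pow_left₀ (mul_nonneg hμ hρ0.le) hμρτ a
  have hconst : 2 * (C₀ * θ ^ a * w) / (γ / 2 * ρ ^ a) + M * μ ^ a * w * (γ / 2 * ρ ^ a)
      ≤ w * ((4 * C₀ / γ + M * γ / 2) * τ ^ a) := by
    have h1 : 2 * (C₀ * θ ^ a * w) / (γ / 2 * ρ ^ a) ≤ w * (4 * C₀ / γ * τ ^ a) := by
      rw [div_le_iff₀ hh0]
      calc 2 * (C₀ * θ ^ a * w) ≤ 2 * (C₀ * (τ ^ a * ρ ^ a) * w) := by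
            have := mul_le_mul_of_nonneg_right (mul_le_mul_of_nonneg_left hθa hC₀) hw0.le
            linarith
        _ = w * (4 * C₀ / γ * τ ^ a) * (γ / 2 * ρ ^ a) := by field_simp; ring
    have h2' : M * μ ^ a * w * (γ / 2 * ρ ^ a) ≤ w * (M * γ / 2 * τ ^ a) := by
      have := mul_le_mul_of_nonneg_left hμa (by positivity : 0 ≤ M * w * (γ / 2))
      calc M * μ ^ a * w * (γ / 2 * ρ ^ a) = M * w * (γ / 2) * (μ ^ a * ρ ^ a) := by ring
        _ ≤ M * w * (γ / 2) * τ ^ a := this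
        _ = w * (M * γ / 2 * τ ^ a) := by ring
    calc _ ≤ w * (4 * C₀ / γ * τ ^ a) + w * (M * γ / 2 * τ ^ a) := add_le_add h1 h2'
      _ = w * ((4 * C₀ / γ + M * γ / 2) * τ ^ a) := by ring
  -- `C₁·τ^{a} = (C₁/τ)·τ^{scale X − i}` since `i < scale X`
  have hpow : (4 * C₀ / γ + M * γ / 2) / τ * τ ^ (C.scale X - i) = (4 * C₀ / γ + M * γ / 2) * τ ^ a := by
    rw [show C.scale X - i = a + 1 by omega, pow_succ]
    field_simp
  show |f s - f s'| ≤ w * ((4 * C₀ / γ + M * γ / 2) / τ * τ ^ (C.scale X - i) * |s - s'|)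
  rw [hpow]
  calc |f s - f s'| ≤ (2 * (C₀ * θ ^ a * w) / (γ / 2 * ρ ^ a) + M * μ ^ a * w * (γ / 2 * ρ ^ a)) * |s - s'| := key
    _ ≤ w * ((4 * C₀ / γ + M * γ / 2) * τ ^ a) * |s - s'| := mul_le_mul_of_nonneg_right hconst (abs_nonneg _)
    _ = w * ((4 * C₀ / γ + M * γ / 2) * τ ^ a * |s - s'|) := by ring

/-! ## §3 HEADLINE: node N22's statement of record from (P) + (O) + (R₂) -/

/-- **HEADLINE — NODE N22 (NE9 ∧ FADING MEMORY), VERTEX-FREE DERIVATIVE-FREE FORM.**  On the abstract output carriers: (P)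
`PrefixDependenceOn E (Window γ)` ([Balaban1987RG1] p. 256, words) ∧ (O) oscillation fading (`C₀ ≥ 0`, `θ ≥ 0`; = tower-NE5, node N18 along
the tower; NOT PRINTED) ∧ (R₂) second differences of every young-coupling section on `]0, γ]` bounded by `M·μ^{age−1}·e^{−κd(X)}·d²` (the
TYPE of [Balaban1987RG1] p. 263's C^∞ clause, read at second order and without the endpoint; unprinted for the older couplings) ⟹ for
every step ratio `ρ ∈ ]0, 1]`, rate `τ > 0` with `θ ≤ τρ`, `μρ ≤ τ`: **`NE9 E (Window γ) κ Λ₁ ∧ FadingMemory C₉ τ Λ₁`**,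
`Λ₁ k i = C₉·τ^{k−i}`, `C₉ = (4C₀∕γ + Mγ∕2)∕τ` — node N22's statement of record BY NAME; fading iff `θμ < 1`. [folklore] -/
theorem ne9_and_fadingMemory_of_osc_secondDiff {γ κ C₀ θ M μ ρ τ : ℝ} (hP : PrefixDependenceOn E (Window γ))
    (hO : ∀ g ∈ Window γ, ∀ g' ∈ Window γ, ∀ (U : Bg) (X : C.Dom) (a : ℕ), a ≤ C.scale X →
      (∀ n, a ≤ n → g n = g' n) → |E g U X - E g' U X| ≤ C₀ * θ ^ (C.scale X - a) * Real.exp (-(κ * C.d X)))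
    (hR2 : ∀ g ∈ Window γ, ∀ (U : Bg) (X : C.Dom) (i : ℕ), i < C.scale X → ∀ t d : ℝ, 0 < d →
      t - d ∈ Ioc (0 : ℝ) γ → t + d ∈ Ioc (0 : ℝ) γ →
        |E (Function.update g i (t + d)) U X - 2 * E (Function.update g i t) U X + E (Function.update g i (t - d)) U X| ≤
          M * μ ^ (C.scale X - 1 - i) * Real.exp (-(κ * C.d X)) * d ^ 2)
    (hC₀ : 0 ≤ C₀) (hθ0 : 0 ≤ θ) (hM : 0 ≤ M) (hμ : 0 ≤ μ) (hγ : 0 < γ) (hρ0 : 0 < ρ) (hρ1 : ρ ≤ 1)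
    (hθτρ : θ ≤ τ * ρ) (hμρτ : μ * ρ ≤ τ) (hτ0 : 0 < τ) :
    NE9 E (Window γ) κ (fun k i => (4 * C₀ / γ + M * γ / 2) / τ * τ ^ (k - i)) ∧
      FadingMemory ((4 * C₀ / γ + M * γ / 2) / τ) τ (fun k i => (4 * C₀ / γ + M * γ / 2) / τ * τ ^ (k - i)) := by
  have hC₁ : 0 ≤ 4 * C₀ / γ + M * γ / 2 := by positivity
  exact ⟨ne9_of_coordLipschitz hP
      (coordLipschitzOn_of_osc_secondDiff hO hR2 hC₀ hθ0 hM hμ hγ hρ0 hρ1 hθτρ hμρτ hτ0),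
    fadingMemory_geometric (div_nonneg hC₁ hτ0.le) hτ0.le⟩

end Abstract

/-! ## §4 With the tower of carriers: node N18 along the tower + (P) + (R₂) ⇒ node N22 at every level -/

section Tower

variable (T : TowerData) {E : ℕ → (ℕ → ℝ) → T.B → T.Dom → ℝ}

/-- **NODE N22 AT EVERY LEVEL FROM NODE N18's TOWER STATEMENT + SECOND DIFFERENCES.**  `TowerNE5 T E γ κ θ C₅` (`C₅ ≥ 0`, `0 ≤ θ < 1`;
node N18 BY NAME along the tower) gives (O) with `C₀ = 2C₅∕(1−θ)` at every level (`N22Knit.oscFading_of_towerNE5`); with (P) and (R₂)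
(constants `M·μ^{age−1}·e^{−κd(X)}`) at every level and `ρ, τ` as in §3: **`TowerNE9 T E γ κ Λ₁ ∧ FadingMemory C₉ τ Λ₁`**,
`C₉ = (4·(2C₅∕(1−θ))∕γ + Mγ∕2)∕τ`. [folklore] -/
theorem towerNE9_fadingMemory_of_towerNE5_secondDiff {γ κ θ C₅ M μ ρ τ : ℝ} (hC : 0 ≤ C₅) (hθ0 : 0 ≤ θ) (hθ1 : θ < 1)
    (h5 : TowerNE5 T E γ κ θ C₅) (hP : ∀ k, PrefixDependenceOn (C := T.level k) (E k) (Window γ))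
    (hR2 : ∀ k, ∀ g ∈ Window γ, ∀ (U : (T.level k).BgA) (X : (T.level k).Dom) (i : ℕ), i < (T.level k).scale X →
      ∀ t d : ℝ, 0 < d → t - d ∈ Ioc (0 : ℝ) γ → t + d ∈ Ioc (0 : ℝ) γ →
        |E k (Function.update g i (t + d)) U X - 2 * E k (Function.update g i t) U X + E k (Function.update g i (t - d)) U X| ≤
          M * μ ^ ((T.level k).scale X - 1 - i) * Real.exp (-(κ * (T.level k).d X)) * d ^ 2)
    (hM : 0 ≤ M) (hμ : 0 ≤ μ) (hγ : 0 < γ) (hρ0 : 0 < ρ) (hρ1 : ρ ≤ 1) (hθτρ : θ ≤ τ * ρ) (hμρτ : μ * ρ ≤ τ)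
    (hτ0 : 0 < τ) :
    TowerNE9 T E γ κ (fun k i => (4 * (2 * C₅ / (1 - θ)) / γ + M * γ / 2) / τ * τ ^ (k - i)) ∧
      FadingMemory ((4 * (2 * C₅ / (1 - θ)) / γ + M * γ / 2) / τ) τ
        (fun k i => (4 * (2 * C₅ / (1 - θ)) / γ + M * γ / 2) / τ * τ ^ (k - i)) := by
  have h1θ : 0 < 1 - θ := by linarith
  have hC₀ : 0 ≤ 2 * C₅ / (1 - θ) := by positivity
  refine ⟨fun k => ?_, fadingMemory_geometric (div_nonneg (by positivity) hτ0.le) hτ0.le⟩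
  exact (ne9_and_fadingMemory_of_osc_secondDiff (C := T.level k) (hP k) (oscFading_of_towerNE5 T hC hθ0 hθ1 h5 k) (hR2 k)
    hC₀ hθ0 hM hμ hγ hρ0 hρ1 hθτρ hμρτ hτ0).1

end Tower

end Summit.QuantumFields.YangMills.BalabanUVNodes.N22KnitDiscrete

end
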